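import Summits.AtomisticToContinuum.Crystallization.Theses.ReggeStarCoercivity
import Summits.AtomisticToContinuum.Crystallization.Theorems.ReggeStarCoercivityDefectFreeCrystallizesExactStarShortcut
import Summits.AtomisticToContinuum.Crystallization.Theorems.ReggeStarCoercivityDefectFreeCrystallizesFunnelSitesDefs
import Summits.AtomisticToContinuum.Crystallization.Theorems.ReggeStarCoercivityDefectFreeCrystallizesRouteBetaRootDiscount
import Literature.MathematicalPhysics.StatisticalMechanics.BarlowStackingEnergy

/-!
# Line `sos-cluster` for crux `ReggeStarCoercivity.DefectFreeCrystallizes` (stmt-AtomisticToContinuum-13603)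
# — strategist gen 3 (seat s3), 2026-08-17.  ALTERNATIVE line; the lead's live skeleton `Lines/palm_good_law.lean` is untouched.

ENGINE.  A REAL-SPACE FINITE-RANGE SUM-OF-SQUARES CERTIFICATE WITH A MASS-TRANSPORT GAUGE: the coercive floor the live line
needs (its κ-CORE `FunnelDefectFloorCore`, law level) is the Mecke image of a POINTWISE gauged floor on single rooted funnel
configurations (stub `stub_gaugedDefectFloorRoot`, S4″ below: own-word reference level as in the lead's S4′ `stub_funnelRigidityRoot`,
but the `1 %`-badness indicator price `+κ·1[¬good]` replaced by the POLYNOMIAL defect price `+κ·D(μ)` of the κ-CORE), and such a pointwise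
floor is exactly what a Putinar/SOS certificate on the compact semialgebraic `1/20`-funnel box produces: per sublattice ONE cluster form
`q ⪰ 0` (SOS modulo the box constraints) with `Σ_x q_(t(x))(translates) ≡ Σ_x (h_x − level_x − κ·D_x)` IDENTICALLY (the Kaburagi–Kanamori /
Huang-et-al. "maximal cluster lower bound with optimised weights" of lattice-gas theory, transplanted from discrete spins + LP to
continuous positions + SDP/SOS; the weights ARE the transfer `t`).  The certificate is FOUND numerically (kit) and CHECKED by rational
arithmetic; the Lean proof of the hard stub is then interval/rational bookkeeping, not analysis.

NECESSARY CONDITION CHECKED (kit j027011, j027085): at the harmonic level the certificate exists iff the label-truncated LJ Hessian at the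
relaxed crystal minus `κ·D″` splits into PSD cluster forms; cluster SDP: FEASIBLE, `κ_loc(13-atom star cluster) ≥ 0.97·κ_glob(Bloch)` at
`R_T = 1.52 a` (full-prestress truncations `R_T ≥ 2.3 a`: see the line card `Lines/sos-cluster.md`).

COMPOSITION (kernel-checked, no sorry outside `stub_*`):
`stub_gaugedDefectFloorRoot` (S4″, XL: the SOS target) → `stub_coreOfGaugedFloor` (S4″ ⇒ κ-CORE, L: Mecke level pricing with the level
function `ℓ = own-word level − W·[root cubic] + κ·Dm − ε`, pattern = landed `RouteBetaReshape.funnelCertificates_of_funnelRigidity` +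
`RouteBetaLawFree.pricedFloor_of_funnelCertificates` + `LevelPricing.stub_levelPricing` + `DefectVersion.stub_defectVersion`) →
the crux BY NAME through the landed `ExactStarShortcut.defectFreeCrystallizes_of_core` (p162359; crux 9226 NOT used).
-/

noncomputable section

open scoped BigOperators ENNReal
open Filter Topology MeasureTheory

namespace Summit.AtomisticToContinuum.Crystallization.Cruxes.DefectFreeCrystallizes.SosCluster

open Summit.AtomisticToContinuum.Crystallization.Theses
open Literature.MathematicalPhysics.StatisticalMechanics Literature.Geometry.DiscreteGeometry
open Literature.Probability.Process
open Summit.AtomisticToContinuum.Crystallization.Theorems.PalmGoodLaw (SetGood)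
open Summit.AtomisticToContinuum.Crystallization.Theorems.PalmGoodLaw (FunnelSites.IsCubicSite65)

/-- **κ-CORE of the live line, verbatim** (the hypothesis of the landed `ExactStarShortcut.defectFreeCrystallizes_of_core`, p162359;
= `PalmGoodLaw.FunnelDefectFloorCore` of `Lines/palm_good_law.lean` v35): energy above the relaxed-hcp level controls the mean star
defect, `hcpE a₀ h₀ + κ·E_P[D] ≤ E_P[h]`, for point-stationary rooted hard-core laws a.s. carried by everywhere-good Barlow-charted
force-balanced configurations with zero mean virial stress. [folklore] -/
def Core : Prop :=
  ∀ a₀ h₀ : ℝ, 189 / 200 ≤ a₀ → a₀ ≤ 199 / 200 → 77 / 100 ≤ h₀ → h₀ ≤ 163 / 200 →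
        (∀ a h : ℝ, 0 < a → 0 < h →
          Summit.AtomisticToContinuum.Crystallization.Theorems.PalmUnimodularRigidity.LayeredLawsSelectHcp.hcpE a₀ h₀ ≤
            Summit.AtomisticToContinuum.Crystallization.Theorems.PalmUnimodularRigidity.LayeredLawsSelectHcp.hcpE a h) →
        ∀ δ : ℝ, 0 < δ → ∃ κ : ℝ, 0 < κ ∧
          ∀ Dm : Measure (EuclideanSpace ℝ (Fin 3)) → ℝ≥0∞, Measurable Dm →
            (∀ μ : Measure (EuclideanSpace ℝ (Fin 3)), IsRootedHardCore δ μ →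
              Dm μ = ENNReal.ofReal
                (min (Summit.AtomisticToContinuum.Crystallization.Theorems.PalmUnimodularRigidity.LayeredLawsSelectHcp.starDefect a₀ h₀ μ)
                    (⨅ A : EuclideanSpace ℝ (Fin 3) ≃ₗᵢ[ℝ] EuclideanSpace ℝ (Fin 3),
                      ∑ p ∈ fccKissingPattern, Metric.infDist (A (a₀ • p)) (Summit.AtomisticToContinuum.Crystallization.Theorems.PalmUnimodularRigidity.LayeredLawsSelectHcp.rootStar μ) ^ 2) +
                  (μ {y : EuclideanSpace ℝ (Fin 3) | 11 / 10 < ‖y‖ ∧ ‖y‖ ≤ 5 / 4}).toReal)) →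
            ∀ P : Measure (Measure (EuclideanSpace ℝ (Fin 3))), IsProbabilityMeasure P →
              (∀ᵐ μ ∂P, IsRootedHardCore δ μ) → IsPointStationaryLaw P →
              (∀ᵐ μ ∂P, ∃ S : Set (EuclideanSpace ℝ (Fin 3)),
                μ = (Measure.count : Measure (EuclideanSpace ℝ (Fin 3))).restrict S ∧
                (∀ y ∈ S, SetGood S y) ∧
                ∃ s : ℤ → ℤ, IsHaggSeq s ∧
                  ∃ Φ : EuclideanSpace ℝ (Fin 3) → EuclideanSpace ℝ (Fin 3),
                    Set.BijOn Φ (barlowStacking 1 (Real.sqrt (2 / 3)) s) S ∧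
                    ∀ p ∈ barlowStacking 1 (Real.sqrt (2 / 3)) s, ∀ q ∈ barlowStacking 1 (Real.sqrt (2 / 3)) s,
                      (dist p q = 1 ↔ (0 < dist (Φ p) (Φ q) ∧ dist (Φ p) (Φ q) < 6 / 5))) →
              (∀ᵐ μ ∂P, ∃ S : Set (EuclideanSpace ℝ (Fin 3)),
                μ = (Measure.count : Measure (EuclideanSpace ℝ (Fin 3))).restrict S ∧
                ∀ p ∈ S, HasSum (fun q : {q : EuclideanSpace ℝ (Fin 3) // q ∈ S ∧ q ≠ p} =>
                  (deriv lennardJones (dist p q.1) / dist p q.1) • (p - q.1)) 0) →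
              (∀ M : EuclideanSpace ℝ (Fin 3) →L[ℝ] EuclideanSpace ℝ (Fin 3),
                ∫ μ, (∫ y, deriv lennardJones ‖y‖ / ‖y‖ * inner ℝ y (M y) ∂μ) ∂P = 0) →
              Summit.AtomisticToContinuum.Crystallization.Theorems.PalmUnimodularRigidity.LayeredLawsSelectHcp.hcpE a₀ h₀ +
                  κ * (∫⁻ μ, Dm μ ∂P).toReal ≤
                ∫ μ, (∫ y, lennardJones ‖y‖ ∂μ) / 2 ∂P

/-- **S4″ — POINTWISE GAUGED DEFECT FLOOR AT THE ROOT (the SOS target).**  For the relaxed reference `(a₀, h₀)` and every hard-core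
radius `δ` there are a price `κ > 0` and a per-fault discount `0 ≤ W ≤ J₃ − J₂` such that for every slack `ε > 0` a BOUNDED FINITE-RANGE
jointly measurable bond transfer `t` makes, on EVERY rooted `δ`-separated everywhere-`SetGood` Barlow-charted force-balanced configuration
`μ = count|S` whose root carries the chart label `(k, i, j)`:
`e_own(s, k) − ε − W·[root cubic] + κ·D(μ) ≤ h(μ) + div t(μ)`,
where `e_own = barlowSiteEnergy lennardJones a₀ h₀ s k` (ideal own-word site energy at the relaxed hcp spacings), `D` is the κ-CORE's
defect functional (nearest rotated relaxed-hcp-star / regular-fcc-star congruence defect of the root star + annulus count) and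
`div t(μ) = ∫ (t μ y − t (θ_y μ) (−y)) dμ(y)`.  It is the lead's de-registered S4′ `stub_funnelRigidityRoot` with the indicator price
`+κ·1[root shell not 1 %-good]` replaced by the polynomial price `+κ·D` — the shape an SOS certificate delivers (cluster polynomial
`≥ 0` on the funnel box ⇒ sum over translates = `h − level − κ·D_CM − div t`, `D_CM ≥ c·D` by Procrustes/Cayley–Menger domination).
WHY IT MIGHT FAIL: exact finite-range splitting may fail at the nonlinear level on the full 5 % box even though it holds harmonically
(kit j027011/j027085); the `∀ ε ∃ R` order absorbs the far field (`|tail| ≤ 0.6/R³`) and the truncation prestress but not a genuine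
box-scale obstruction. [folklore] -/
def GaugedDefectFloorRoot : Prop :=
  ∀ a₀ h₀ : ℝ, 189 / 200 ≤ a₀ → a₀ ≤ 199 / 200 → 77 / 100 ≤ h₀ → h₀ ≤ 163 / 200 →
      (∀ a h : ℝ, 0 < a → 0 < h → Summit.AtomisticToContinuum.Crystallization.Theorems.PalmUnimodularRigidity.LayeredLawsSelectHcp.hcpE a₀ h₀ ≤ Summit.AtomisticToContinuum.Crystallization.Theorems.PalmUnimodularRigidity.LayeredLawsSelectHcp.hcpE a h) →
      ∀ δ : ℝ, 0 < δ → ∃ κ : ℝ, 0 < κ ∧ ∃ W : ℝ, 0 ≤ W ∧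
        W ≤ barlowCoupling lennardJones a₀ h₀ 3 - barlowCoupling lennardJones a₀ h₀ 2 ∧
        ∀ ε : ℝ, 0 < ε →
          ∃ R M : ℝ, ∃ t : Measure (EuclideanSpace ℝ (Fin 3)) → EuclideanSpace ℝ (Fin 3) → ℝ,
            (Measurable (Function.uncurry t) ∧ (∀ μ y, |t μ y| ≤ M) ∧ ∀ μ y, R < ‖y‖ → t μ y = 0) ∧
            ∀ (μ : Measure (EuclideanSpace ℝ (Fin 3))) (S : Set (EuclideanSpace ℝ (Fin 3))) (s : ℤ → ℤ)
              (Φ : EuclideanSpace ℝ (Fin 3) → EuclideanSpace ℝ (Fin 3)),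
              μ = (Measure.count : Measure (EuclideanSpace ℝ (Fin 3))).restrict S →
              (0 : EuclideanSpace ℝ (Fin 3)) ∈ S → (∀ x ∈ S, ∀ y ∈ S, x ≠ y → δ ≤ dist x y) →
              (∀ y ∈ S, SetGood S y) → IsHaggSeq s →
              Set.BijOn Φ (barlowStacking 1 (Real.sqrt (2 / 3)) s) S →
              (∀ p ∈ barlowStacking 1 (Real.sqrt (2 / 3)) s, ∀ q ∈ barlowStacking 1 (Real.sqrt (2 / 3)) s,
                (dist p q = 1 ↔ (0 < dist (Φ p) (Φ q) ∧ dist (Φ p) (Φ q) < 6 / 5))) →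
              (∀ p ∈ S, HasSum (fun q : {q : EuclideanSpace ℝ (Fin 3) // q ∈ S ∧ q ≠ p} =>
                (deriv lennardJones (dist p q.1) / dist p q.1) • (p - q.1)) 0) →
              ∀ k i j : ℤ, Φ (barlowPos 1 (Real.sqrt (2 / 3)) s k i j) = 0 →
                barlowSiteEnergy lennardJones a₀ h₀ s k - ε -
                      {S' : Set (EuclideanSpace ℝ (Fin 3)) | FunnelSites.IsCubicSite65 S' 0}.indicator (fun _ => W) S +
                    κ * (min (Summit.AtomisticToContinuum.Crystallization.Theorems.PalmUnimodularRigidity.LayeredLawsSelectHcp.starDefect a₀ h₀ μ)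
                            (⨅ A : EuclideanSpace ℝ (Fin 3) ≃ₗᵢ[ℝ] EuclideanSpace ℝ (Fin 3),
                              ∑ p ∈ fccKissingPattern, Metric.infDist (A (a₀ • p)) (Summit.AtomisticToContinuum.Crystallization.Theorems.PalmUnimodularRigidity.LayeredLawsSelectHcp.rootStar μ) ^ 2) +
                          (μ {y : EuclideanSpace ℝ (Fin 3) | 11 / 10 < ‖y‖ ∧ ‖y‖ ≤ 5 / 4}).toReal) ≤
                  (∫ y, lennardJones ‖y‖ ∂μ) / 2 + ∫ y, (t μ y - t (Measure.map (fun z => z - y) μ) (-y)) ∂μ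

/-- **stub S4″** (XL; the SOS/Putinar certificate — see the module docstring and `Lines/sos-cluster.md`). [folklore] -/
theorem stub_gaugedDefectFloorRoot : GaugedDefectFloorRoot := by
  sorry

/-- **stub GLUE** (L): the pointwise gauged defect floor prices into the κ-CORE.  Mecke level pricing (`LevelPricing.stub_levelPricing`)
with the `P`-integrable level function `ℓ(μ) = e_own(germ of the word at the root) − W·C(μ,0) + κ·Dm(μ) − ε` (`C` the measurable
root-covariant cubic mark of `CubicMarkVersion.stub_cubicMarkVersion`, `Dm` the given measurable version of `D`, bounded on rooted
hard-core configurations by `DefectVersion.stub_defectVersion` + `AnnulusCount.stub_annulusCount`); then `E_P[e_own − W·C] ≥ hcpE a₀ h₀`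
exactly as in the landed `RouteBetaReshape.funnelCertificates_of_funnelRigidity` (covariant Mecke count of cubic neighbours
`RootCubicCount.stub_rootCubicCount`, the LJ site-energy column `SiteColumnLJ.stub_siteColumnLJ`, `W ≤ J₃ − J₂`), and `ε ↓ 0`.
Pattern landed twice (route β v24–v26); no new idea. [folklore] -/
theorem stub_coreOfGaugedFloor : GaugedDefectFloorRoot → Core := by
  sorry

/-- **COMPOSITION (sorry-free): the crux BY NAME from the two stubs**, through the landed exact-star shortcut
`ExactStarShortcut.defectFreeCrystallizes_of_core` (p162359) — crux 9226 is not used. [folklore] -/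
theorem DefectFreeCrystallizes_of (h₁ : GaugedDefectFloorRoot) (h₂ : GaugedDefectFloorRoot → Core) :
    Summit.AtomisticToContinuum.Crystallization.Theses.ReggeStarCoercivity.DefectFreeCrystallizes :=
  Summit.AtomisticToContinuum.Crystallization.Theorems.PalmGoodLaw.ExactStarShortcut.defectFreeCrystallizes_of_core (h₂ h₁)

/-- The line closes the crux modulo its registered stubs. [folklore] -/
theorem DefectFreeCrystallizes_closed :
    Summit.AtomisticToContinuum.Crystallization.Theses.ReggeStarCoercivity.DefectFreeCrystallizes :=
  DefectFreeCrystallizes_of stub_gaugedDefectFloorRoot stub_coreOfGaugedFloor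

end Summit.AtomisticToContinuum.Crystallization.Cruxes.DefectFreeCrystallizes.SosCluster

end
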